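import Literature.MathematicalPhysics.QuantumLattice.MatrixProductStatesGroundStateProofs
import Literature.MathematicalPhysics.QuantumLattice.SpinSystemProofs
import HarnessLib

/-!
# Discharged fact: the periodic MPS is a zero-energy ground state of its parent Hamiltonian

Trunk **T-QLATTICE**. Sibling proof file of
`Literature/MathematicalPhysics/QuantumLattice/MatrixProductStates.lean`, next to
`MatrixProductStatesProofs.lean`, `MatrixProductStatesAkltProofs.lean` and
`MatrixProductStatesGroundStateProofs.lean` (the open-chain ground-state property, whose lemma
`parentLocalTerm_mulVec_mpsWithBoundary` — `h ψ_B = 0` — is reused here). It discharges the named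
fact (`def X : Prop`, D-0014)

* `Literature.MathematicalPhysics.QuantumLattice.parentHamiltonian_mulVec_mps_eq_zero` — *for
  `ℓ ≤ L`, the translation-invariant parent Hamiltonian `H = Σ_{x ∈ ℤ/L} h_{x,…,x+ℓ-1}`,
  `h = 1 - P_{𝒢_ℓ}`, of an MPS tensor `A` annihilates the periodic MPS
  `ψ(σ) = tr (A^{σ₀} ⋯ A^{σ_{L-1}})` on the ring `ℤ/L`: `H ψ = 0`*

as `parentHamiltonian_mulVec_mps_eq_zero_holds`, from Mathlib, `SpinSystemProofs`
(`localOp_mulVec_apply`: how `A ⊗ 𝟙` acts on vectors) and `MatrixProductStatesGroundStateProofs`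
(`parentLocalTerm_mulVec_mpsWithBoundary`). Theorems only: no statement of `MatrixProductStates`
is changed and no definition is introduced.

## Source

* Fannes–Nachtergaele–Werner, CMP **144** (1992), §5. Eq. (5.5) (p. 465) defines
  `Γ_n(B) = Σ_{μ₁…μ_n} ψ_{μ₁} ⊗ ⋯ ⊗ ψ_{μ_n} Tr(B v(μ_n)^* ⋯ v(μ₁)^*)` and the range
  `𝒢_n = Γ_n(ℬ) ⊂ ℋ^{⊗n}` with orthogonal projection `G_n`; Def. 5.4 (p. 468): "A positive
  operator `h ∈ 𝒜^{⊗ℓ}` is called an interaction exposing `ω`, if `ℓ ≥ ℓ₀`, and the kernel of `h`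
  coincides with `𝒢_ℓ = Γ_ℓ(ℬ)`. The Hamiltonian of the system is then the formal expression
  `H = Σ_i α_i(h)`, where `α_i(h) ∈ 𝒜_{{i+1,…,i+ℓ}}` is the `i`th translate of `h`", followed by
  "By Lemma 5.1 the `ℓ`-step density matrix of `ω` has support in `𝒢_ℓ` so `ω(h) = 0`, realizes
  the smallest possible energy density, and `ω` is a ground state in this sense" and (before
  Lemma 5.5) "the kernel of `H_{{1,…,m}}` is clearly equal to the intersection of the kernels of
  the positive operators `h_k`".
* Perez-Garcia–Verstraete–Wolf–Cirac, QIC **7** (2007), §4.1.2 (arXiv p. 11, the paragraph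
  before Theorem 10), which is the finite-ring form vendored here: "Given our ring of `N`
  `d`-dimensional quantum systems, `L ≤ N` and a subspace `S` of `(ℂ^d)^{⊗L}`, we denote
  `H_S = Σ_{i=1}^N τ^i(h_S)`, where `h_S` is the projection onto `S^⊥` … the subspace `𝒢_L`
  formed by the elements `Σ tr(X A_{i₁} ⋯ A_{i_L}) |i₁ ⋯ i_L⟩`. It is clear that
  `H_{𝒢_L} |ψ⟩ = 0` and that `H_{𝒢_L}` is frustration free."

Here `h = parentLocalTerm ℓ A = projMatrix (mpsRange ℓ A)ᗮ` is the canonical exposing interaction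
`1 - G_ℓ`, `mpsRange ℓ A = 𝒢_ℓ` is spanned by the boundary MPS `ψ_B = mpsWithBoundary ℓ A B`
(`= Γ_ℓ(B)` up to the relabelling `v(μ) = (A^μ)^*`), and `parentHamiltonian L ℓ A` places `h` on
every block `{x, …, x+ℓ-1} ⊆ ℤ/L` (`ringBlock`, `onRingBlock`, `localOp`).

## Proof

The printed mechanism — *every `ℓ`-site slice of `ψ` lies in `𝒢_ℓ = ker h`* — made explicit on
the ring:

1. `parentLocalTerm_mulVec_mpsWithBoundary` (from `MatrixProductStatesGroundStateProofs`):
   `h ψ_B = 0` for every boundary matrix `B`, since `ψ_B ∈ 𝒢_ℓ` and `h` is the orthogonal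
   projection onto `𝒢_ℓᗮ`.
2. `parentHamiltonian_mulVec_eq_zero_of_exists_boundary` (frustration-freeness, the linear
   algebra of `Σ_x α_x(h)` on the ring): if for every block start `x` and every configuration `σ`
   there is a boundary matrix `B` with `φ(τ) = ψ_B(τ_x, …, τ_{x+ℓ-1})` for all `τ` agreeing with
   `σ` off the block, then `H φ = 0`. Indeed `α_x(h) = localOp (ringBlock L ℓ x) (h.submatrix e e)`
   acts on the block slices of `φ` (`localOp_mulVec_apply` of `SpinSystemProofs`), the
   relabelling `e : i ↦ x + i`, `Fin ℓ → ringBlock L ℓ x`, is a bijection for `ℓ ≤ L`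
   (`ringBlockSite_bijective`; this is where `ℓ ≤ L` enters), so each block slice of `α_x(h) φ`
   is `h ψ_B = 0` reindexed (`Fintype.sum_bijective`).
3. `parentHamiltonian_mulVec_mps_eq_zero_holds`: for the periodic MPS the hypothesis of 2 holds
   with `B` the word product over the complementary arc `x+ℓ, …, x+L-1`: by cyclicity of the
   trace the word may be started at `x` (`trace_wordProduct_comp_finEquiv`, via
   `trace_prod_rotate` = `tr (X Y) = tr (Y X)` for `List.rotate`, and `ofFn_rotate`), then split
   after `ℓ` letters (`wordProduct_natCast_add`, `List.ofFn_add`), and the second factor only sees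
   sites off the block (`add_natCast_notMem_ringBlock`), where `τ = σ`.

## References

* M. Fannes, B. Nachtergaele, R. F. Werner, *Finitely correlated states on quantum spin chains*,
  Comm. Math. Phys. **144** (1992) 443–490, doi:10.1007/bf02099178, §5: eq. (5.5) (p. 465),
  Def. 5.4 and the discussion up to Lemma 5.5 (p. 468). [FannesNachtergaeleWernerCMP1992]
* D. Perez-Garcia, F. Verstraete, M. M. Wolf, J. I. Cirac, *Matrix product state
  representations*, Quantum Inf. Comput. **7** (2007) 401–430, arXiv:quant-ph/0608197, §4.1.2
  (paragraph before Theorem 10). [PerezGarciaVerstraeteWolfCiracQIC2007]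
-/

noncomputable section

open Matrix

namespace Literature.MathematicalPhysics.QuantumLattice

section QLattice

variable {q D : ℕ}

/-! ### Blocks of the ring `ℤ/L` -/

/-- For `ℓ ≤ L` the labelling `i ↦ x + i` of the block `{x, …, x+ℓ-1} ⊆ ℤ/L` by `Fin ℓ` is a
bijection (injective since `i < ℓ ≤ L` determines `i` from `i mod L`; onto by definition of
`ringBlock` as an image). [folklore] -/
theorem ringBlockSite_bijective (L ℓ : ℕ) [NeZero L] (hℓ : ℓ ≤ L) (x : ZMod L) :
    Function.Bijective (ringBlockSite L ℓ x) := by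
  refine ⟨fun i j hij => ?_, fun y => ?_⟩
  · have h : x + ((i : ℕ) : ZMod L) = x + ((j : ℕ) : ZMod L) := congrArg Subtype.val hij
    have h' := congrArg ZMod.val (add_left_cancel h)
    rw [ZMod.val_cast_of_lt (i.2.trans_le hℓ), ZMod.val_cast_of_lt (j.2.trans_le hℓ)] at h'
    exact Fin.ext h'
  · obtain ⟨y, hy⟩ := y
    obtain ⟨i, -, rfl⟩ := Finset.mem_image.1 hy
    exact ⟨i, rfl⟩

/-- The sites `x + n`, `ℓ ≤ n < L`, of the ring `ℤ/L` lie off the block `{x, …, x+ℓ-1}`.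
[folklore] -/
theorem add_natCast_notMem_ringBlock {L ℓ : ℕ} (x : ZMod L) {n : ℕ} (hℓn : ℓ ≤ n)
    (hn : n < L) : x + (n : ZMod L) ∉ ringBlock L ℓ x := by
  intro h
  obtain ⟨i, -, hi⟩ := Finset.mem_image.1 h
  have h' := congrArg ZMod.val (add_left_cancel hi)
  rw [ZMod.val_cast_of_lt ((i.2.trans_le hℓn).trans hn), ZMod.val_cast_of_lt hn] at h'
  exact absurd (h' ▸ i.2) (not_lt.2 hℓn)

/-! ### Frustration-freeness: `H φ = 0` when every block slice of `φ` is a boundary MPS -/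

/-- **Frustration-freeness of the parent Hamiltonian on the ring.** Let `ℓ ≤ L`. If a vector `φ`
on the ring `ℤ/L` is, along every block `{x, …, x+ℓ-1}` and for every frozen configuration `σ`
off the block, a boundary MPS — i.e. there is `B ∈ M_D(ℂ)` with `φ(τ) = ψ_B(τ_x, …, τ_{x+ℓ-1})`
for all `τ` agreeing with `σ` off the block — then `H φ = Σ_x α_x(h) φ = 0`: each translate
`α_x(h)` acts by `h` on the block slices of `φ` (`localOp_mulVec_apply`, after relabelling the
block by `Fin ℓ` along the bijection `i ↦ x + i`), and these lie in `𝒢_ℓ = ker h`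
(`parentLocalTerm_mulVec_mpsWithBoundary`). This is the mechanism "support in `𝒢_ℓ` ⇒
annihilated by every `h_k`" of Fannes–Nachtergaele–Werner (1992) §5, p. 468 (Def. 5.4 and the
discussion before Lemma 5.5), on the ring as in Perez-Garcia–Verstraete–Wolf–Cirac (2007)
§4.1.2 ("`H_{𝒢_L}` is frustration free"). [cite: FannesNachtergaeleWernerCMP1992, §5 Def. 5.4 and p. 468] -/
theorem parentHamiltonian_mulVec_eq_zero_of_exists_boundary (L : ℕ) [NeZero L] (ℓ : ℕ)
    (hℓ : ℓ ≤ L) (A : MPSTensor q D) (φ : TensorIndex (ZMod L) q → ℂ)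
    (hφ : ∀ (x : ZMod L) (σ : TensorIndex (ZMod L) q), ∃ B : Matrix (Fin D) (Fin D) ℂ,
      ∀ τ : TensorIndex (ZMod L) q, (∀ y, y ∉ ringBlock L ℓ x → σ y = τ y) →
        φ τ = mpsWithBoundary ℓ A B (fun i : Fin ℓ => τ (x + ((i : ℕ) : ZMod L)))) :
    parentHamiltonian L ℓ A *ᵥ φ = 0 := by
  rw [parentHamiltonian, Matrix.sum_mulVec]
  funext σ
  rw [Finset.sum_apply, Pi.zero_apply]
  refine Finset.sum_eq_zero fun x _ => ?_
  obtain ⟨B, hB⟩ := hφ x σ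
  rw [localOp_mulVec_apply]
  -- reindex the block slice along the bijection `i ↦ x + i`
  have hf : Function.Bijective fun (ρ : ringBlock L ℓ x → Fin q) (i : Fin ℓ) =>
      ρ (ringBlockSite L ℓ x i) :=
    (ringBlockSite_bijective L ℓ hℓ x).comp_right
  refine (Fintype.sum_bijective _ hf _
    (fun w => parentLocalTerm ℓ A (fun i => σ (x + ((i : ℕ) : ZMod L))) w *
      mpsWithBoundary ℓ A B w) fun ρ => ?_).trans
    (congrFun (parentLocalTerm_mulVec_mpsWithBoundary ℓ A B) _)
  show onRingBlock L ℓ x (parentLocalTerm ℓ A) (fun y => σ y) ρ *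
      φ (Subtype.val.extend ρ σ) = _
  rw [hB (Subtype.val.extend ρ σ) fun y hy => (Function.extend_val_apply' hy).symm]
  have he : (fun i : Fin ℓ => Subtype.val.extend ρ σ (x + ((i : ℕ) : ZMod L))) =
      fun i => ρ (ringBlockSite L ℓ x i) :=
    funext fun i => Subtype.val_injective.extend_apply ρ σ (ringBlockSite L ℓ x i)
  rw [he]
  rfl

/-! ### Cyclicity of the trace along the ring -/

/-- `ZMod.finEquiv L : Fin L ≃+* ZMod L` is the cast `i ↦ (i : ℕ)` (for `L = n + 1` it is the
identity of `Fin (n + 1)`). [folklore] -/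
theorem finEquiv_apply_eq_natCast (L : ℕ) [NeZero L] (i : Fin L) :
    ZMod.finEquiv L i = ((i : ℕ) : ZMod L) := by
  cases L with
  | zero => exact i.elim0
  | succ n => exact (ZMod.natCast_zmod_val (n := n + 1) i).symm

/-- Rotating the list of values of `f : Fin n → α` by `k` gives the list of values of
`i ↦ f ((k + i) mod n)` (`List.getElem_rotate`). [folklore] -/
theorem ofFn_rotate {α : Type*} {n : ℕ} (f : Fin n → α) (k : ℕ) :
    (List.ofFn f).rotate k =
      List.ofFn fun i : Fin n => f ⟨(k + i) % n, Nat.mod_lt _ i.pos⟩ := by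
  apply List.ext_getElem
  · simp
  · intro j h₁ h₂
    simp [List.getElem_rotate, Nat.add_comm]

/-- Cyclicity of the trace for a product of matrices: `tr (M_k ⋯ M_{n-1} M₀ ⋯ M_{k-1}) =
tr (M₀ ⋯ M_{n-1})` (`tr (X Y) = tr (Y X)` with `X = M₀ ⋯ M_{k-1}`, `Y = M_k ⋯ M_{n-1}`).
[folklore] -/
theorem trace_prod_rotate (l : List (Matrix (Fin D) (Fin D) ℂ)) (k : ℕ) :
    (l.rotate k).prod.trace = l.prod.trace := by
  rw [List.rotate_eq_drop_append_take_mod, List.prod_append, Matrix.trace_mul_comm,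
    ← List.prod_append, List.take_append_drop]

/-- The periodic MPS amplitude may be read off starting at any site `x` of the ring:
`tr (A^{τ₀} A^{τ₁} ⋯ A^{τ_{L-1}}) = tr (A^{τ_x} A^{τ_{x+1}} ⋯ A^{τ_{x+L-1}})` (indices in `ℤ/L`),
by cyclicity of the trace. Fannes–Nachtergaele–Werner (1992) §5, eq. (5.5) at `B = 𝟙`;
Perez-Garcia–Verstraete–Wolf–Cirac (2007) §3.2.2. [folklore] -/
theorem trace_wordProduct_comp_finEquiv (L : ℕ) [NeZero L] (A : MPSTensor q D)
    (τ : TensorIndex (ZMod L) q) (x : ZMod L) :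
    (wordProduct A (τ ∘ ZMod.finEquiv L)).trace =
      (wordProduct A fun i : Fin L => τ (x + ((i : ℕ) : ZMod L))).trace := by
  rw [wordProduct, wordProduct, ← trace_prod_rotate _ x.val, ofFn_rotate]
  simp only [Function.comp_apply, finEquiv_apply_eq_natCast, Nat.cast_add, ZMod.natCast_mod,
    ZMod.natCast_zmod_val]

/-- Splitting a word of length `ℓ + m` after `ℓ` letters:
`A^{g 0} ⋯ A^{g (ℓ+m-1)} = (A^{g 0} ⋯ A^{g (ℓ-1)}) (A^{g ℓ} ⋯ A^{g (ℓ+m-1)})` (`List.ofFn_add`).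
[folklore] -/
theorem wordProduct_natCast_add (A : MPSTensor q D) {ℓ m : ℕ} (g : ℕ → Fin q) :
    wordProduct A (fun i : Fin (ℓ + m) => g i) =
      wordProduct A (fun i : Fin ℓ => g i) * wordProduct A (fun j : Fin m => g (ℓ + j)) := by
  simp [wordProduct, List.ofFn_add]

/-! ### The ground-state property -/

/-- **Discharge of `parentHamiltonian_mulVec_mps_eq_zero` (ground-state property of the parent
Hamiltonian).** For `ℓ ≤ L` the periodic MPS `ψ(σ) = tr (A^{σ₀} ⋯ A^{σ_{L-1}})` on the ring `ℤ/L`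
is annihilated by `H = Σ_{x ∈ ℤ/L} h_{x,…,x+ℓ-1}`, `h = 1 - P_{𝒢_ℓ}`. Writing `L = ℓ + m`, for a
block starting at `x` and any `τ` one has, by cyclicity of the trace and splitting the word after
`ℓ` letters, `ψ(τ) = tr (B · A^{τ_x} ⋯ A^{τ_{x+ℓ-1}}) = ψ_B(τ_x, …, τ_{x+ℓ-1})` with
`B = A^{τ_{x+ℓ}} ⋯ A^{τ_{x+ℓ+m-1}}` depending only on `τ` off the block; so every block slice of `ψ`
lies in `𝒢_ℓ = ker h` and `parentHamiltonian_mulVec_eq_zero_of_exists_boundary` applies.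
Fannes–Nachtergaele–Werner (1992) §5: eq. (5.5) (p. 465), Def. 5.4 and p. 468 ("By Lemma 5.1 the
`ℓ`-step density matrix of `ω` has support in `𝒢_ℓ` so `ω(h) = 0` … and `ω` is a ground state in
this sense"; "the kernel of `H_{{1,…,m}}` is clearly equal to the intersection of the kernels of
the positive operators `h_k`"); the finite-ring form is Perez-Garcia–Verstraete–Wolf–Cirac (2007)
§4.1.2, before Theorem 10 ("`L ≤ N` … It is clear that `H_{𝒢_L} |ψ⟩ = 0` and that `H_{𝒢_L}` is
frustration free"). [cite: FannesNachtergaeleWernerCMP1992, §5 Def. 5.4 and p. 468] -/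
theorem parentHamiltonian_mulVec_mps_eq_zero_holds :
    parentHamiltonian_mulVec_mps_eq_zero (q := q) (D := D) := by
  intro L _ ℓ hℓ A
  refine parentHamiltonian_mulVec_eq_zero_of_exists_boundary L ℓ hℓ A _ fun x σ => ?_
  obtain ⟨m, rfl⟩ := Nat.exists_eq_add_of_le hℓ
  refine ⟨wordProduct A fun j : Fin m => σ (x + ((ℓ + (j : ℕ) : ℕ) : ZMod (ℓ + m))),
    fun τ hτ => ?_⟩
  show mpsPeriodic (ℓ + m) A (τ ∘ _) = _
  rw [mpsPeriodic_apply, trace_wordProduct_comp_finEquiv (ℓ + m) A τ x,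
    wordProduct_natCast_add A (fun n : ℕ => τ (x + (n : ZMod (ℓ + m)))),
    Matrix.trace_mul_comm]
  -- off the block `τ = σ`, so the complementary word product is the chosen `B`
  have hout : ∀ j : Fin m, τ (x + ((ℓ + (j : ℕ) : ℕ) : ZMod (ℓ + m))) =
      σ (x + ((ℓ + (j : ℕ) : ℕ) : ZMod (ℓ + m))) := fun j =>
    (hτ _ (add_natCast_notMem_ringBlock x (Nat.le_add_right ℓ j)
      (Nat.add_lt_add_left j.2 ℓ))).symm
  simp only [hout]
  rfl

end QLattice

end Literature.MathematicalPhysics.QuantumLattice
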